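import Literature.AnabelianGeometry.EtaleTheta.Discharge.Sec1Thm16iiiOfThm16ii
import Literature.AnabelianGeometry.EtaleTheta.Thm16SubdagCompanion
import HarnessLib

/-!
# [EtTh] Thm. 1.6 (iii): the compatibility clause «γ ∘ ια = ιβ ∘ γ» is FREE — inversion automorphisms TRANSPORT along
# `γ`; what remains is the normalisation of the transported inversion (proof-only)

Mochizuki, *The étale theta function and its Frobenioid-theoretic manifestations*, Publ. RIMS **45** (2009), proof of
Thm. 1.6 (iii), p. 25 l. 15–19: «By composing γ with an appropriate inner automorphism of Π^tp_{Xβ}, it follows from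
[SemiAnbd], Theorem 6.8, (ii), that we may assume that the isomorphism Π^tp_{Ÿα} ⥲ Π^tp_{Ÿβ} is compatible with suitable
“inversion automorphisms” ια, ιβ [cf. Proposition 1.5, (iii)] on both sides»; l. 33–34 «a cusp that maps to the
irreducible component of the special fiber of Ÿ labeled 0 [e.g., a cusp that is preserved by the inversion
automorphism]» [cite: MochizukiEtTh2009, Thm 1.6 (iii) p.25]. abc-iut cell, layer L2, seat abc-iut-L2-t1 (§1 ROOT
owner). PROOF-ONLY (0 `def`).

The capstones `thm16iii_of_inversionClauses` / `_of_rootClauses` / `_of_thm16ii_rootClauses` take COMPATIBLE inversion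
automorphisms `ια`, `ιβ`. HERE: for any inversion automorphism `ια` of `Π^tp_{Xα}` (`IsInversionAut`), the transported
automorphism `ιβ := γ ∘ ια ∘ γ⁻¹` IS an inversion automorphism of `Π^tp_{Xβ}` as soon as `γ` carries `Δ^tp_{Xα}` onto
`Δ^tp_{Xβ}` ([AbsAnab] Lem. 1.3.8, K3 row L01) and the coverings `Y_N`, `Z_N` onto those of `β` (Prop. 1.8 / Thm 1.6
(i)-type clauses) — and it is compatible with `γ` by construction. So the compatibility clause carries NO content; the
content of print's appeal to [SemiAnbd] Thm. 6.8 (ii) is that the TRANSPORTED inversion is the one «fixing the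
component labelled 0» of `β`, i.e. that it satisfies Prop. 1.5 (iii)'s clause for `Eβ` — which the root FACT-shaped
predicate `Prop15iiiInvAnchored Eβ` yields from ONE anchored component-0 cusp datum of `β` fixed by `γ ια γ⁻¹`.
* `ThetaSetting.IsInversionAut.transport` — `IsInversionAut ια ⇒ IsInversionAut (γ ∘ ια ∘ γ⁻¹)`;
* `ThetaSetting.compat_transport` — the compatibility clause for the transported inversion (by construction);
* `Thm16Sub.thm16iii_of_prop15iiiInv` — [EtTh] Thm. 1.6 (iii) from `thm16iii_of_thm16ii_rootClauses` with `ιβ`, `hιβ`,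
  `hcompat` ELIMINATED and `hInvβ` SUPPLIED by `Prop15iiiInvAnchored Eβ` + an anchored component-0 cusp datum of `β` fixed
  by the transported inversion (print l. 33–34).
HONEST FRAMING: [EtTh] is refereed; nothing here bears on [IUTchIII] Cor. 3.12; typed ≠ proved; no side taken.
-/

noncomputable section

namespace Literature.AnabelianGeometry.EtaleTheta

open Literature.AnabelianGeometry.SemiGraphs

namespace ThetaSetting

variable {p : ℕ} [Fact p.Prime] {Dα Dβ : ThetaSetting p} {γ : Dα.PiTemp ≃ₜ* Dβ.PiTemp}
  {ια : Dα.PiTemp ≃ₜ* Dα.PiTemp}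

/-- `γ` carries a subgroup it is known to carry: membership transfer. [cite: MochizukiEtTh2009, Thm 1.6 (i) p.24] -/
theorem mem_of_map_eq {H : Subgroup Dα.PiTemp} {H' : Subgroup Dβ.PiTemp}
    (h : H.map γ.toMulEquiv.toMonoidHom = H') {x : Dα.PiTemp} (hx : x ∈ H) : γ x ∈ H' := by
  rw [← h]; exact ⟨x, hx, rfl⟩

/-- … and back along `γ⁻¹`. [cite: MochizukiEtTh2009, Thm 1.6 (i) p.24] -/
theorem symm_mem_of_map_eq {H : Subgroup Dα.PiTemp} {H' : Subgroup Dβ.PiTemp}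
    (h : H.map γ.toMulEquiv.toMonoidHom = H') {y : Dβ.PiTemp} (hy : y ∈ H') : γ.symm y ∈ H := by
  rw [← h] at hy
  obtain ⟨x, hx, rfl⟩ := hy
  change γ.symm (γ x) ∈ H
  rw [γ.symm_apply_apply]
  exact hx

/-- The transported automorphism preserves a subgroup carried by `γ` and preserved by `ια`.
[cite: MochizukiEtTh2009, Thm 1.6 (i) p.24] -/
theorem map_transport_eq {H : Subgroup Dα.PiTemp} {H' : Subgroup Dβ.PiTemp}
    (h : H.map γ.toMulEquiv.toMonoidHom = H') (hι : H.map ια.toMulEquiv.toMonoidHom = H) :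
    H'.map ((γ.symm.trans ια).trans γ).toMulEquiv.toMonoidHom = H' := by
  ext y
  constructor
  · rintro ⟨z, hz, rfl⟩
    change γ (ια (γ.symm z)) ∈ H'
    exact mem_of_map_eq h (mem_of_map_eq (γ := ια) hι (symm_mem_of_map_eq h hz))
  · intro hy
    refine ⟨γ (ια.symm (γ.symm y)), ?_, ?_⟩
    · have h1 : ια.symm (γ.symm y) ∈ H := by
        have : ια.symm (γ.symm y) ∈ H.map ια.symm.toMulEquiv.toMonoidHom := ⟨γ.symm y, symm_mem_of_map_eq h hy, rfl⟩
        rwa [IsInversionAut.map_symm_eq_of_map_eq hι] at this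
      exact mem_of_map_eq h h1
    · change γ (ια (γ.symm (γ (ια.symm (γ.symm y))))) = y
      rw [γ.symm_apply_apply, ια.apply_symm_apply, γ.apply_symm_apply]

/-- **Inversion automorphisms transport along `γ`.** If `ια` is an inversion automorphism of `Π^tp_{Xα}` and
`γ : Π^tp_{Xα} ⥲ Π^tp_{Xβ}` carries `Δ^tp_X`, the coverings `Y_N` and `Z_N` of `α` onto those of `β`, then
`ιβ := γ ∘ ια ∘ γ⁻¹` is an inversion automorphism of `Π^tp_{Xβ}`: over `K` (`x⁻¹·ια(x) ∈ Δ^tp`), `−1` on `Z`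
(`ια(x)·x ∈ Π^tp_Y`), `−1` on `(Δ^tp_X)^ell` (`ια(x)·x ∈ Ker((·)^ell)`, carried by `γ`: abc-iut-L6-d5's
`map_ker_toEll_eq`), preserving `Y_N`, `Z_N`. [cite: MochizukiEtTh2009, Thm 1.6 (iii) p.25] -/
theorem IsInversionAut.transport (hι : Dα.IsInversionAut ια)
    (hΔ : Dα.DeltaTemp.map γ.toMulEquiv.toMonoidHom = Dβ.DeltaTemp)
    (hYN : ∀ N, (Dα.GtpYN N).map γ.toMulEquiv.toMonoidHom = Dβ.GtpYN N)
    (hZN : ∀ N, (Dα.GtpZN N).map γ.toMulEquiv.toMonoidHom = Dβ.GtpZN N) :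
    Dβ.IsInversionAut ((γ.symm.trans ια).trans γ) where
  aug_apply g := by
    change Dβ.aug (γ (ια (γ.symm g))) = Dβ.aug g
    set x := γ.symm g with hx
    have hg : g = γ x := (γ.apply_symm_apply g).symm
    -- `ια(x) · x⁻¹ ∈ Δ^tp_α`, carried into `Δ^tp_β` by `γ`
    have hmem : ια x * x⁻¹ ∈ Dα.DeltaTemp := by
      change Dα.aug.toMonoidHom (ια x * x⁻¹) = 1
      rw [map_mul, map_inv]
      change Dα.aug (ια x) * (Dα.aug x)⁻¹ = 1
      rw [hι.aug_apply, mul_inv_cancel]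
    have hβ : Dβ.aug.toMonoidHom (γ (ια x * x⁻¹)) = 1 := mem_of_map_eq hΔ hmem
    rw [map_mul, map_inv, map_mul, map_inv, mul_inv_eq_one] at hβ
    rw [hg]
    exact hβ
  toZ_apply g := by
    change Dβ.toZ (γ (ια (γ.symm g))) = (Dβ.toZ g)⁻¹
    set x := γ.symm g with hx
    have hg : g = γ x := (γ.apply_symm_apply g).symm
    have hmem : ια x * x ∈ Dα.GtpYN 1 := by
      rw [Dα.GtpYN_one, MonoidHom.mem_ker, map_mul, hι.toZ_apply, inv_mul_cancel]
    have hβ : γ (ια x * x) ∈ Dβ.GtpYN 1 := mem_of_map_eq (hYN 1) hmem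
    rw [Dβ.GtpYN_one, MonoidHom.mem_ker, map_mul, map_mul, mul_eq_one_iff_eq_inv] at hβ
    rw [hg]
    exact hβ
  ell_apply g hgΔ := by
    change Dβ.thetaToEll (Dβ.toTheta (γ (ια (γ.symm g)))) = (Dβ.thetaToEll (Dβ.toTheta g))⁻¹
    set x := γ.symm g with hx
    have hg : g = γ x := (γ.apply_symm_apply g).symm
    have hxΔ : x ∈ Dα.DeltaTemp := symm_mem_of_map_eq hΔ hgΔ
    have hmem : ια x * x ∈ (Dα.thetaToEll.comp Dα.toTheta).ker := by
      rw [MonoidHom.mem_ker, MonoidHom.comp_apply, map_mul, map_mul, hι.ell_apply x hxΔ, inv_mul_cancel]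
    have hβ : γ (ια x * x) ∈ (Dβ.thetaToEll.comp Dβ.toTheta).ker :=
      mem_of_map_eq (Thm16Sub.map_ker_toEll_eq Dα Dβ γ hΔ) hmem
    rw [MonoidHom.mem_ker, MonoidHom.comp_apply, map_mul, map_mul, map_mul, mul_eq_one_iff_eq_inv] at hβ
    rw [hg]
    exact hβ
  map_GtpYN N := map_transport_eq (hYN N) (hι.map_GtpYN N)
  map_GtpZN N := map_transport_eq (hZN N) (hι.map_GtpZN N)

/-- **The compatibility clause holds for the transported inversion, by construction.**
[cite: MochizukiEtTh2009, Thm 1.6 (iii) p.25] -/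
theorem compat_transport (g : Dα.PiTemp) :
    γ.toMulEquiv (ια.toMulEquiv g) = ((γ.symm.trans ια).trans γ).toMulEquiv (γ.toMulEquiv g) := by
  change γ (ια g) = γ (ια (γ.symm (γ g)))
  rw [γ.symm_apply_apply]

end ThetaSetting

namespace Thm16Sub

open Literature.AnabelianGeometry.SemiGraphs

variable {p : ℕ} [Fact p.Prime] {Dα Dβ : ThetaSetting p} {γ : Dα.PiTemp ≃ₜ* Dβ.PiTemp}

/-- **[EtTh] Theorem 1.6 (iii) from Prop. 1.5 (iii)'s ROOT predicate on the β side and ONE transported inversion.**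
As `thm16iii_of_thm16ii_rootClauses`, with the β-side inversion automorphism TAKEN TO BE the transport `γ ∘ ια ∘ γ⁻¹`
of the α-side one (compatibility free, `IsInversionAut` transported along `γ` given `hΔ` and the covering clauses
`hYN`/`hZN`), and its Prop. 1.5 (iii) clause SUPPLIED by the root predicate `Prop15iiiInvAnchored Eβ` at an anchored
cusp datum `yβ` of `β` over the component labelled `0` FIXED by the transported inversion («e.g., a cusp that is
preserved by the inversion automorphism», p. 25). [cite: MochizukiEtTh2009, Thm 1.6 (iii) p.25] -/
theorem thm16iii_of_prop15iiiInv (h : ThetaSetting.Thm16i γ) (c : ThetaSetting.ThetaCompanion γ)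
    (hΔ : Dα.DeltaTemp.map γ.toMulEquiv.toMonoidHom = Dβ.DeltaTemp)
    (hYN : ∀ N, (Dα.GtpYN N).map γ.toMulEquiv.toMonoidHom = Dβ.GtpYN N)
    (hZN : ∀ N, (Dα.GtpZN N).map γ.toMulEquiv.toMonoidHom = Dβ.GtpZN N)
    (Eα : Dα.EtaleThetaData) (Eβ : Dβ.EtaleThetaData) (hCα : Dα.Compat) (hCβ : Dβ.Compat)
    (hSβ : Dβ.Sec2Hyps) (h15iiα : ThetaSetting.Prop15ii Eα.toKummerData hCα)
    (h15ii : ThetaSetting.Prop15ii Eβ.toKummerData hCβ)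
    (h15α : ThetaSetting.Prop15iii Eα hCα) (h15β : ThetaSetting.Prop15iii Eβ hCβ)
    {σ : Dβ.PiTemp} (hσ : σ ∈ Dβ.GtpYdd)
    (Vα : ThetaSetting.ValuationHatData Dα Eα.toKummerData)
    (Vβ : ThetaSetting.ValuationHatData Dβ Eβ.toKummerData)
    (hVα : Vα.unitsHat = Dα.unitsOKdd.map Eα.toKddHat) (hVβ : Vβ.unitsHat = Dβ.unitsOKdd.map Eβ.toKddHat)
    (h16ii : ThetaSetting.Thm16ii γ h Eα.toKummerData Eβ.toKummerData Vα Vβ)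
    (hTβ : Dβ.HasThetaTopology) (hOβ : Dβ.IsEtThOrigin)
    {lamβ : ↥((Dβ.DtpYddN 1).map Dβ.toTheta) →ₜ* Dβ.DeltaTheta} (hstdβ : ThetaSetting.IsStdLog lamβ)
    (hresβ : ContH1.res (MonoidHom.id Dβ.GtpTheta) Dβ.DeltaTheta Dβ.map_toTheta_DtpYddN_one_le Eβ.logUdd =
      ThetaSetting.homClass ThetaSetting.dtpYddTheta_le_deltaTheta_map lamβ)
    -- the α-side inversion automorphism with its Prop 1.5 (iii) clause; the β side from the ROOT FACT predicate
    {ια : Dα.PiTemp ≃ₜ* Dα.PiTemp} (hια : Dα.IsInversionAut ια) (cα : ThetaSetting.ThetaCompanion ια)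
    (hInvα : ThetaSetting.InvClauses Eα hια cα)
    (cβ : ThetaSetting.ThetaCompanion ((γ.symm.trans ια).trans γ))
    (h15invβ : Dβ.Prop15iiiInvAnchored Eβ)
    (yβ : ThetaSetting.CuspidalPointDd Eβ.toKummerData) (hyβA : yβ.IsAnchored) (hyβ0 : yβ.IsOnLabelZero)
    (hyβfix : Dβ.FixesCuspBelow ((γ.symm.trans ια).trans γ) yβ)
    -- row L15: the two cusp evaluations
    (y : ThetaSetting.CuspidalPointDd Eβ.toKummerData) {u₁ u₂ v₁ v₂ : (↥Dβ.Kdd)ˣ}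
    (hu₁ : u₁ ∈ Dβ.unitsOKdd) (hu₂ : u₂ ∈ Dβ.unitsOKdd)
    (hv : ‖((v₁ : Dβ.Kdd) : PadicAlgCl p)‖ = ‖((v₂ : Dβ.Kdd) : PadicAlgCl p)‖)
    (h₁ : haveI := hCβ.GtpYdd_normal
      y.evalAt (ContH1.res Dβ.toTheta Dβ.DeltaTheta (y.sec_le.trans y.Dpt_le)
        (ContH1.conj Dβ.toTheta Dβ.DeltaTheta σ Eβ.etaDd)) = Eβ.toKddHat (u₁ * v₁))
    (h₂ : y.evalAt (ContH1.res Dβ.toTheta Dβ.DeltaTheta (y.sec_le.trans y.Dpt_le)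
        (ThetaSetting.transport c h Eα.etaDd)) = Eβ.toKddHat (u₂ * v₂)) :
    ThetaSetting.Thm16iii γ h c Eα Eβ hCβ :=
  have hιβ : Dβ.IsInversionAut ((γ.symm.trans ια).trans γ) := hια.transport hΔ hYN hZN
  thm16iii_of_thm16ii_rootClauses h c hΔ Eα Eβ hCα hCβ hSβ h15iiα h15ii h15α h15β hσ Vα Vβ hVα hVβ h16ii hTβ hOβ
    hstdβ hresβ hια cα hInvα hιβ cβ (h15invβ _ hιβ cβ yβ hyβA hyβ0 hyβfix) (fun g => ThetaSetting.compat_transport g)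
    y hu₁ hu₂ hv h₁ h₂

end Thm16Sub

end Literature.AnabelianGeometry.EtaleTheta

end
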